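import Mathlib
import Summits.ResolutionOfSingularities.ResolutionOfSingularities.Theorems.HomologicalConductorNoZenoDim2RegularCentre
import Literature.AlgebraicGeometry.Resolution.AffineDomainDimension
import HarnessLib

/-!
# G1 for rung S-2 `PersistenceSurface`: every tower stage has Krull dimension `≤ dim A`

Item `HomologicalConductor.PersistenceSurface` (stmt-ResolutionOfSingularities-19970), rung S-2 of crux
`Persistence` (stmt-ResolutionOfSingularities-16484), chain W4.4b, CRUX-PLAN v3 §3.2 glue piece G1
(ASSIGN v0.7, stub-2-successor row "G1 (tower dimension ≤ 2 from dim A ≤ 2) for the S-2 glue"; taken by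
stub-3 successor, the stub-2 seat being empty). `[OURS · L1 w44b]`; bookkeeping over landed lemmas, not a
statement of any manuscript; AI-drafted (weaker than expert review).

The item's binders give `A : Subalgebra k K` with `A.FG`, `IsFractionRing ↥A K` and `ringKrullDim ↥A ≤ 2`;
the S-2 glue needs `ringKrullDim ↥(tower O A m) ≤ 2` at EVERY stage of the canonical normalised
`ca`-tower (`NoZeno.Birth.tower`, the crux's `tower` by `NoZeno.Birth` vocabulary). The tree has
`NoZeno.Birth.d2rc_ringKrullDim_tower_le` (stage dimension `≤ tr.deg_k K`) and the affine dimension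
formula (`Literature.AlgebraicGeometry.Resolution.exists_ringKrullDim_eq_and_trdeg_eq`,
`trdeg_eq_trdeg_of_isFractionRing`); we only compose:

* `trdeg_le_of_ringKrullDim_le` — `dim A ≤ d ⇒ tr.deg_k K ≤ d` for an affine model `A` of `K/k`;
* `trdeg_eq_of_ringKrullDim_eq` — `dim A = d ⇒ tr.deg_k K = d`;
* `ringKrullDim_tower_le_of_ringKrullDim_le` — **G1**: `dim A ≤ d ⇒ dim T_m ≤ d` for all `m`.
-/

-- single-problem summit: the doubled namespace component is forced
set_option linter.dupNamespace false

noncomputable section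

namespace Summit.ResolutionOfSingularities.ResolutionOfSingularities.Theorems.HomologicalConductor.PersistenceSurfaceTowerDim

open Literature.AlgebraicGeometry.Resolution
open Summit.ResolutionOfSingularities.ResolutionOfSingularities.Theorems.NoZeno.Birth

variable {k K : Type} [Field k] [Field K] [Algebra k K]

/-- **`dim A ≤ d ⇒ tr.deg_k K ≤ d`** for a finitely generated `k`-subalgebra `A ⊆ K` with
`Frac A = K` (`dim A = tr.deg_k A = tr.deg_k K`). [cite: Matsumura1987, Thm. 5.6] -/
theorem trdeg_le_of_ringKrullDim_le (A : Subalgebra k K) (hfg : A.FG) [IsFractionRing A K]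
    {d : ℕ} (hA : ringKrullDim A ≤ d) : Algebra.trdeg k K ≤ d := by
  haveI : Algebra.FiniteType k A := A.fg_iff_finiteType.mp hfg
  obtain ⟨n, hn, htr⟩ := exists_ringKrullDim_eq_and_trdeg_eq k A
  rw [trdeg_eq_trdeg_of_isFractionRing A, htr]
  rw [hn] at hA
  exact_mod_cast hA

/-- **`dim A = d ⇒ tr.deg_k K = d`** for a finitely generated `k`-subalgebra `A ⊆ K` with
`Frac A = K`. [cite: Matsumura1987, Thm. 5.6] -/
theorem trdeg_eq_of_ringKrullDim_eq (A : Subalgebra k K) (hfg : A.FG) [IsFractionRing A K]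
    {d : ℕ} (hA : ringKrullDim A = d) : Algebra.trdeg k K = d := by
  haveI : Algebra.FiniteType k A := A.fg_iff_finiteType.mp hfg
  obtain ⟨n, hn, htr⟩ := exists_ringKrullDim_eq_and_trdeg_eq k A
  rw [trdeg_eq_trdeg_of_isFractionRing A, htr]
  rw [hn] at hA
  exact_mod_cast hA

/-- **G1: every stage of the canonical normalised `ca`-tower of `(A, O)` has Krull dimension
`≤ dim A`.** For `A ⊆ K` a finitely generated `k`-subalgebra with `Frac A = K` and `dim A ≤ d`:
`ringKrullDim ↥(tower O A m) ≤ d` for every `m` (so under the binders of `PersistenceSurface`,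
stmt-ResolutionOfSingularities-19970, every `T_m` has dimension `≤ 2`).
[cite: Matsumura1987, Thm. 5.6] -/
theorem ringKrullDim_tower_le_of_ringKrullDim_le (O : ValuationSubring K) (A : Subalgebra k K)
    (hfg : A.FG) [IsFractionRing A K] {d : ℕ} (hA : ringKrullDim A ≤ d) (m : ℕ) :
    ringKrullDim ↥(tower O A m) ≤ d :=
  d2rc_ringKrullDim_tower_le O A m (trdeg_le_of_ringKrullDim_le A hfg hA)

end Summit.ResolutionOfSingularities.ResolutionOfSingularities.Theorems.HomologicalConductor.PersistenceSurfaceTowerDim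

end
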